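import Mathlib.MeasureTheory.Function.L2Space
import Mathlib.MeasureTheory.Integral.Bochner.Basic
import Mathlib.Analysis.SpecialFunctions.Pow.Real
import Mathlib.Analysis.SpecialFunctions.Sqrt
import HarnessLib

/-!
# The Cauchy–Schwarz step of Garban's multi-scale bound (orthogonal revealment sums)

Topic `Literature/Probability/Percolation`; support file for the named fact
`Literature.Probability.Percolation.Garban2011_fourArm_multiscale` (`FourArmGarban.lean`).
Proofs only (no definition, no named fact).

In C. Garban's proof of the multi-scale four-arm bound (Appendix B of O. Schramm, S. Smirnov,
Ann. Probab. 39 (2011), proof of Lemma B.1, display (B.8) and the two displays after it) — and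
verbatim in the self-contained `m = 1` version of J. van den Berg, P. Nolin (Progr. Probab. 77
(2020), §5.2, last display) — the pivotal estimates are summed through one analytic step:

> "Summing over all `Q_j`'s, we use the Cauchy–Schwarz inequality to write
> `Σ_j E[X C_j Y_j] = E[X Σ_j C_j Y_j] ≤ √(E[X²]) · √(E[(Σ_j C_j Y_j)²]) = √(E[X²]) · √(Σ_{i,j} E[C_i Y_i C_j Y_j])`.
> In the last sum, nondiagonal terms vanish. [...] Thus, we can continue, leaving only the
> diagonal terms [...] `= √(Σ_j E[C_j² Y_j²])`."

(O'Donnell–Servedio's inequality for decision trees has the same skeleton.) This file proves that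
step once and for all for real random variables on a finite measure space:

* `integral_sq_finsetSum_eq_of_orthogonal` — `∫ (Σ_j g_j)² = Σ_j ∫ g_j²` for pairwise orthogonal
  `g_j ∈ L²`;
* `finsetSum_integral_mul_le_sqrt_mul_sqrt_of_orthogonal` — **`Σ_j ∫ f g_j ≤ √(∫ f²) · √(Σ_j ∫ g_j²)`**
  for `f ∈ L²` and pairwise orthogonal `g_j ∈ L²` (Garban's (B.8) with the diagonal evaluation);
* `finsetSum_integral_mul_indicator_le_of_orthogonal` — the form in which it is used: with
  `g_j = C_j · 1_{V_j}`, `|C_j| ≤ K`, one gets `Σ_j ∫_{V_j} f C_j ≤ √(∫ f²) · K · √(Σ_j μ(V_j))`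
  ("`E[C_j²] ≲ 1`, `Y_j² = Y_j`", so that only the revealment probabilities `μ(V_j) = P[Y_j]`
  remain).

## References

* O. Schramm, S. Smirnov (appendix by C. Garban), *On the scaling limits of planar percolation*,
  Ann. Probab. 39 (2011), Appendix B, proof of Lemma B.1, (B.8) [SchrammSmirnov2011].
* J. van den Berg, P. Nolin, *On the four-arm exponent for 2D percolation at criticality*,
  Progr. Probab. 77 (2020), §5.2 [VandenbergNolin2020].

Mathlib: `MeasureTheory.integral_mul_norm_le_Lp_mul_Lq` (Hölder), `MemLp.integrable_mul`,
`memLp_finsetSum`, `integral_finset_sum`, `memLp_two_iff_integrable_sq`.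
-/

noncomputable section

namespace Literature.Probability.Percolation

open _root_.MeasureTheory Finset

variable {Ω : Type*} [MeasurableSpace Ω] {μ : Measure Ω} {ι : Type*}

/-- **Orthogonal expansion of a square.** For pairwise orthogonal `g_j ∈ L²(μ)`,
`∫ (Σ_{j ∈ J} g_j)² dμ = Σ_{j ∈ J} ∫ g_j² dμ` ("nondiagonal terms vanish"; Schramm–Smirnov 2011,
App. B, after (B.8)). [cite: SchrammSmirnov2011, Appendix B, proof of Lemma B.1, after (B.8)] -/
theorem integral_sq_finsetSum_eq_of_orthogonal (J : Finset ι) {g : ι → Ω → ℝ}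
    (hg : ∀ j ∈ J, MemLp (g j) 2 μ)
    (horth : ∀ i ∈ J, ∀ j ∈ J, i ≠ j → ∫ ω, g i ω * g j ω ∂μ = 0) :
    ∫ ω, (∑ j ∈ J, g j ω) ^ 2 ∂μ = ∑ j ∈ J, ∫ ω, g j ω ^ 2 ∂μ := by
  have hint : ∀ i ∈ J, ∀ j ∈ J, Integrable (fun ω => g i ω * g j ω) μ := fun i hi j hj =>
    (hg i hi).integrable_mul (hg j hj)
  have hexp : ∀ ω, (∑ j ∈ J, g j ω) ^ 2 = ∑ i ∈ J, ∑ j ∈ J, g i ω * g j ω := fun ω => by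
    rw [sq, Finset.sum_mul_sum]
  simp_rw [hexp]
  rw [integral_finsetSum _ fun i hi => integrable_finsetSum _ fun j hj => hint i hi j hj]
  refine Finset.sum_congr rfl fun i hi => ?_
  rw [integral_finsetSum _ fun j hj => hint i hi j hj]
  rw [Finset.sum_eq_single_of_mem i hi fun j hj hji => horth i hi j hj (Ne.symm hji)]
  simp_rw [sq]

/-- **The Cauchy–Schwarz step (Garban's (B.8) with the diagonal evaluation).** For `f ∈ L²(μ)`
and pairwise orthogonal `g_j ∈ L²(μ)`,
`Σ_{j ∈ J} ∫ f g_j dμ ≤ √(∫ f² dμ) · √(Σ_{j ∈ J} ∫ g_j² dμ)`. [cite: SchrammSmirnov2011, Appendix B, proof of Lemma B.1, (B.8)] -/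
theorem finsetSum_integral_mul_le_sqrt_mul_sqrt_of_orthogonal [IsFiniteMeasure μ] (J : Finset ι)
    {f : Ω → ℝ} {g : ι → Ω → ℝ} (hf : MemLp f 2 μ) (hg : ∀ j ∈ J, MemLp (g j) 2 μ)
    (horth : ∀ i ∈ J, ∀ j ∈ J, i ≠ j → ∫ ω, g i ω * g j ω ∂μ = 0) :
    ∑ j ∈ J, ∫ ω, f ω * g j ω ∂μ ≤
      Real.sqrt (∫ ω, f ω ^ 2 ∂μ) * Real.sqrt (∑ j ∈ J, ∫ ω, g j ω ^ 2 ∂μ) := by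
  set G : Ω → ℝ := fun ω => ∑ j ∈ J, g j ω with hG
  have hGm : MemLp G 2 μ := memLp_finsetSum J hg
  -- `Σ_j ∫ f g_j = ∫ f G`
  have hint : ∀ j ∈ J, Integrable (fun ω => f ω * g j ω) μ := fun j hj =>
    hf.integrable_mul (hg j hj)
  have hsum : ∑ j ∈ J, ∫ ω, f ω * g j ω ∂μ = ∫ ω, f ω * G ω ∂μ := by
    rw [← integral_finsetSum _ hint]
    refine integral_congr_ae (ae_of_all _ fun ω => ?_)
    simp only [hG, Finset.mul_sum]
  -- Cauchy–Schwarz `∫ f G ≤ ∫ |f| |G| ≤ √(∫ f²) √(∫ G²)`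
  have hf' : MemLp f (ENNReal.ofReal 2) μ := by rwa [ENNReal.ofReal_ofNat]
  have hG' : MemLp G (ENNReal.ofReal 2) μ := by rwa [ENNReal.ofReal_ofNat]
  have hCS := integral_mul_norm_le_Lp_mul_Lq Real.HolderConjugate.two_two hf' hG'
  have habs : ∫ ω, f ω * G ω ∂μ ≤ ∫ ω, ‖f ω‖ * ‖G ω‖ ∂μ := by
    refine integral_mono (hf.integrable_mul hGm) ?_ fun ω => ?_
    · have := (hf.norm).integrable_mul hGm.norm
      exact this
    · simp only [Real.norm_eq_abs]
      rw [← abs_mul]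
      exact le_abs_self _
  have h2f : ∫ ω, ‖f ω‖ ^ (2 : ℝ) ∂μ = ∫ ω, f ω ^ 2 ∂μ :=
    integral_congr_ae (ae_of_all _ fun ω => by
      simp only; rw [Real.norm_eq_abs, Real.rpow_two, sq_abs])
  have h2G : ∫ ω, ‖G ω‖ ^ (2 : ℝ) ∂μ = ∫ ω, G ω ^ 2 ∂μ :=
    integral_congr_ae (ae_of_all _ fun ω => by
      simp only; rw [Real.norm_eq_abs, Real.rpow_two, sq_abs])
  rw [h2f, h2G] at hCS
  rw [hsum, ← integral_sq_finsetSum_eq_of_orthogonal J hg horth]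
  calc ∫ ω, f ω * G ω ∂μ ≤ ∫ ω, ‖f ω‖ * ‖G ω‖ ∂μ := habs
    _ ≤ (∫ ω, f ω ^ 2 ∂μ) ^ (1 / (2 : ℝ)) * (∫ ω, G ω ^ 2 ∂μ) ^ (1 / (2 : ℝ)) := hCS
    _ = Real.sqrt (∫ ω, f ω ^ 2 ∂μ) * Real.sqrt (∫ ω, G ω ^ 2 ∂μ) := by
        rw [Real.sqrt_eq_rpow, Real.sqrt_eq_rpow]

/-- **The form used by Garban and van den Berg–Nolin.** Let `f ∈ L²(μ)` (`μ` finite), let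
`V_j` be measurable sets ("`Y_j = 1_{V_j}`, the square `Q_j` is visited by the interface") and
`C_j` measurable with `|C_j| ≤ K`, and assume the products `C_j 1_{V_j}` are pairwise orthogonal
("for `i ≠ j`, `E[C_i Y_i C_j Y_j] = 0`"). Then
`Σ_j ∫_{V_j} f C_j dμ ≤ √(∫ f² dμ) · K · √(Σ_j μ(V_j))`
(Schramm–Smirnov 2011, App. B: (B.8) continued with `E[C_j²] ≲ 1`, `Y_j² = Y_j`; van den
Berg–Nolin 2020, §5.2, last display, with `|C_j| ≤ 1`). [cite: SchrammSmirnov2011, Appendix B, proof of Lemma B.1, (B.8) and the display after it] -/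
theorem finsetSum_integral_mul_indicator_le_of_orthogonal [IsFiniteMeasure μ] (J : Finset ι)
    {f : Ω → ℝ} {C : ι → Ω → ℝ} {V : ι → Set Ω} {K : ℝ} (hK : 0 ≤ K) (hf : MemLp f 2 μ)
    (hCm : ∀ j ∈ J, AEStronglyMeasurable (C j) μ) (hCK : ∀ j ∈ J, ∀ ω, |C j ω| ≤ K)
    (hV : ∀ j ∈ J, MeasurableSet (V j))
    (horth : ∀ i ∈ J, ∀ j ∈ J, i ≠ j →
      ∫ ω, (V i).indicator (C i) ω * (V j).indicator (C j) ω ∂μ = 0) :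
    ∑ j ∈ J, ∫ ω in V j, f ω * C j ω ∂μ ≤
      Real.sqrt (∫ ω, f ω ^ 2 ∂μ) * (K * Real.sqrt (∑ j ∈ J, μ.real (V j))) := by
  classical
  set g : ι → Ω → ℝ := fun j => (V j).indicator (C j) with hg
  have hgK : ∀ j ∈ J, ∀ ω, |g j ω| ≤ K := fun j hj ω => by
    simp only [hg, Set.indicator_apply]
    split_ifs
    · exact hCK j hj ω
    · simpa using hK
  have hgm : ∀ j ∈ J, MemLp (g j) 2 μ := fun j hj =>
    MemLp.of_bound ((hCm j hj).indicator (hV j hj)) K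
      (ae_of_all _ fun ω => by simpa [Real.norm_eq_abs] using hgK j hj ω)
  -- `∫_{V_j} f C_j = ∫ f g_j`
  have hset : ∀ j ∈ J, ∫ ω in V j, f ω * C j ω ∂μ = ∫ ω, f ω * g j ω ∂μ := fun j hj => by
    rw [← integral_indicator (hV j hj)]
    refine integral_congr_ae (ae_of_all _ fun ω => ?_)
    simp only [hg, Set.indicator_apply]
    split_ifs <;> simp
  rw [Finset.sum_congr rfl hset]
  refine (finsetSum_integral_mul_le_sqrt_mul_sqrt_of_orthogonal J hf hgm horth).trans ?_
  refine mul_le_mul_of_nonneg_left ?_ (Real.sqrt_nonneg _)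
  -- `∫ g_j² ≤ K² μ(V_j)`
  have hsq : ∀ j ∈ J, ∫ ω, g j ω ^ 2 ∂μ ≤ K ^ 2 * μ.real (V j) := fun j hj => by
    have hpt : ∀ ω, g j ω ^ 2 ≤ (V j).indicator (fun _ => K ^ 2) ω := fun ω => by
      simp only [hg, Set.indicator_apply]
      split_ifs with h
      · have := hCK j hj ω
        rw [← sq_abs]
        exact pow_le_pow_left₀ (abs_nonneg _) this 2
      · simp
    calc ∫ ω, g j ω ^ 2 ∂μ ≤ ∫ ω, (V j).indicator (fun _ => K ^ 2) ω ∂μ :=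
          integral_mono (hgm j hj).integrable_sq ((integrable_const _).indicator (hV j hj)) hpt
      _ = K ^ 2 * μ.real (V j) := by
          rw [integral_indicator (hV j hj), setIntegral_const, smul_eq_mul, mul_comm]
  calc Real.sqrt (∑ j ∈ J, ∫ ω, g j ω ^ 2 ∂μ)
      ≤ Real.sqrt (∑ j ∈ J, K ^ 2 * μ.real (V j)) := Real.sqrt_le_sqrt (Finset.sum_le_sum hsq)
    _ = K * Real.sqrt (∑ j ∈ J, μ.real (V j)) := by
        rw [← Finset.mul_sum, Real.sqrt_mul (sq_nonneg K), Real.sqrt_sq hK]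

end Literature.Probability.Percolation
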